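import Summits.Ventures.YMGap.RobustBall.CentreProjectionFlux
import Summits.Ventures.YMGap.RobustBall.CentreBlindAreaLaw
import Summits.Ventures.YMGap.RobustBall.CentreSchur
import HarnessLib

/-!
# RobustBall/CentreTubeAreaLaw — the CENTRE-TUBE AREA LAW: the window-free, ball-free area law of the
# centre-blind class survives every plaquette-flux-local twist defect of amplitude `a`, `2(d−1)(N|β| + a) < 1`

HONEST FRAMING: venture file of the cell `pub-ymgap` (QuantumFields programme), track Y2 ROBUST-BALL, seat ds-4
g8.  WHAT THIS IS: a strong-coupling LATTICE theorem, uniform in the volume — for every `N ≥ 2`, every `d`, every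
torus `L` and every perturbation `W` of the `SU(N)` Wilson action whose twist defect is plaquette-flux-local with
amplitude `a` (`IsFluxLocal a W`: `W(ζ_k U) = c(U) + ∑_q g_q((curl k)_q, U)`, `|g| ≤ a`, NOTHING asked of the
twist-invariant part `c` — no ball, no range, no window), the fundamental `R × T` Wilson loops obey
`|⟨W_{R×T}⟩_{β,W,L}| ≤ C^{2(R+T)} e^{−c RT}` with ONE pair `(C, c) = (2, −log max(2(d−1)(N|β| + a), 1/2))` whenever
`2(d−1)(N|β| + a) < 1` (`areaLawCentreTube`).  At `a = 0` this is gen 7's window-free centre-blind area law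
`AreaLawCentreBlind` (ROBUST-BALL-STATEMENT §6(c), `AreaLawCentreTube.areaLawCentreBlind`); for `a > 0` the class
is no longer a closed subspace («a structural restriction, not small perturbations», §6(c) NOTE) but the OPEN
`a`-TUBE around the whole centre-blind affine subspace in the plaquette-flux directions: `W_b + ∑_q f_q(U_q)` with
`W_b` linkwise centre-blind of ANY size and range and `f_q` ANY bounded plaquette densities of ANY `N`-ality,
inhomogeneous in `q`, `½ max_q osc f_q ≤ a` (`CentreTubeMembers`).  HONEST LABEL (ROBUST-BALL-STATEMENT §6(c) verbatim
+ one clause): a strong-coupling lattice INEQUALITY between expectations (centre dominance) + a `ℤ_N`-layer area law —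
no confinement claim for `SU(N)` beyond that; `β`-window SMALLER than tier 1's (SU(2), `d = 4`: `β_W + a < 1/6` vs the
5/8 frontier); nonzero-`N`-ality (fundamental) loops only; nothing continuum / spectral / Clay; no string-tension
EXISTENCE claim for non-Wilson members; AND the tube is open ONLY in the single-plaquette flux-local directions — the
screening loop terms of `not_areaLawOnBallC` (T15) and multi-plaquette terms of nonzero `N`-ality (a `1×2` rectangle's
twist defect reads two fluxes) are OUTSIDE `IsFluxLocal`, so this is NOT «an open ball around the centre-blind class»
in the full carrier.

Mechanism: `CentreProjectionFlux` (centre dominance with a flux-local defect) + `ZNFluxPeeling` (uniform area law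
for `ℤ_N` lattice gauge theories with arbitrary plaquette-flux weights, `|G| ≤ |β|N + a`).  References for the
blind case AS PRINTED: J. Fröhlich, Phys. Lett. B 83 (1979) 195, Eq. (7)–(9); G. Mack, V. B. Petkova, Ann. Phys. 123
(1979) 442, §2.
-/

noncomputable section

open Finset
open Literature.MathematicalPhysics.QuantumLattice (fundamentalRep)
open Literature.MathematicalPhysics.QuantumFieldTheory

namespace Summit.Ventures.YMGap.RobustBall

variable {d L N : ℕ}

/-! ### The currency -/

/-- **`AreaLawCentreTube N d β a`** — the body of `AreaLawCentreBlind` / `AreaLawOnBall` with the hypothesis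
`IsFluxLocal a W` (flux-local twist defect of amplitude `a`; NO radii, NO range, NO window on the twist-invariant
part): constants `C, c > 0` such that for every torus `L`, every such `W` and every non-wrapping `R × T` rectangle,
`|⟨W_{R×T}⟩_{β,W,L}| ≤ C^{2(R+T)} e^{−c RT}`. [folklore] -/
def AreaLawCentreTube (N d : ℕ) [NeZero N] (β a : ℝ) : Prop :=
  ∃ C c : ℝ, 0 < c ∧ ∀ (L : ℕ) [NeZero L] (W : Perturbation d L N), IsFluxLocal a W →
    ∀ (x : Site d L) (i j : Fin d) (R T : ℕ), i ≠ j → 1 ≤ R → 1 ≤ T → 2 * R ≤ L → 2 * T ≤ L →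
      |W.expectation (fundamentalRep (Fin N)) β (wilsonLoop (fundamentalRep (Fin N)) x i j R T)| ≤
        C ^ (2 * (R + T)) * Real.exp (-c * (R * T))

/-- The tube currency is antitone in the amplitude. [folklore] -/
theorem AreaLawCentreTube.anti [NeZero N] {β a a' : ℝ} (h : a' ≤ a) (hA : AreaLawCentreTube N d β a) :
    AreaLawCentreTube N d β a' := by
  obtain ⟨C, c, hc, hA⟩ := hA
  exact ⟨C, c, hc, fun L _ W hW => hA L W (hW.mono h)⟩

/-- **The tube contains the centre-blind class**: `AreaLawCentreTube N d β a` (`0 ≤ a`) implies gen 7's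
`AreaLawCentreBlind N d β` with the same constants. [folklore] -/
theorem AreaLawCentreTube.areaLawCentreBlind [NeZero N] {β a : ℝ} (ha : 0 ≤ a) (hA : AreaLawCentreTube N d β a) :
    AreaLawCentreBlind N d β := by
  obtain ⟨C, c, hc, hA⟩ := hA
  exact ⟨C, c, hc, fun L _ W hW => hA L W (hW.isFluxLocal.mono ha)⟩

/-- **The converse bridge at radius `0`**: gen 7's `AreaLawCentreBlind N d β` gives `AreaLawCentreTube N d β 0` with
the same constants (`IsFluxLocal 0 ↔ IsTwistBlind ↔ IsCentreBlind`, Schur `CentreSchur`). [folklore] -/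
theorem AreaLawCentreBlind.areaLawCentreTube_zero [NeZero N] {β : ℝ} (hA : AreaLawCentreBlind N d β) :
    AreaLawCentreTube N d β 0 := by
  obtain ⟨C, c, hc, hA⟩ := hA
  exact ⟨C, c, hc, fun L _ W hW => hA L W hW.isTwistBlind.isCentreBlind⟩

/-- **`AreaLawCentreTube N d β 0 ↔ AreaLawCentreBlind N d β`**: the tube of radius `0` is the centre-blind class
(rb-theory T-P1). [folklore] -/
theorem areaLawCentreTube_zero_iff [NeZero N] {β : ℝ} : AreaLawCentreTube N d β 0 ↔ AreaLawCentreBlind N d β :=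
  ⟨AreaLawCentreTube.areaLawCentreBlind le_rfl, AreaLawCentreBlind.areaLawCentreTube_zero⟩

/-! ### The theorem -/

/-- **THE CENTRE-TUBE AREA LAW**: for every `N ≥ 2`, every `d`, every tree coupling `β` and amplitude `a ≥ 0` with
`2(d−1)·(N|β| + a) < 1`, `AreaLawCentreTube N d β a` holds with `C = 2` and rate
`c = −log max(2(d−1)(N|β| + a), 1/2)`.  HONEST LABEL: strong-coupling lattice statement, finite tori uniformly in
`L`, fundamental loops; `β`-window smaller than tier 1's; nothing continuum / spectral / Clay.
[cite: Frohlich1979ZN, Eq. (7)–(9)] -/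
theorem areaLawCentreTube [NeZero N] (hN : 2 ≤ N) {β a : ℝ} (ha : 0 ≤ a)
    (hβ : 2 * ((d - 1 : ℕ) : ℝ) * (|β| * N + a) < 1) : AreaLawCentreTube N d β a := by
  set c := max (2 * ((d - 1 : ℕ) : ℝ) * (|β| * N + a)) (1 / 2) with hcdef
  have hc0 : 0 < c := lt_max_of_lt_right (by norm_num)
  have hc1 : c < 1 := max_lt hβ (by norm_num)
  have hcle : 2 * ((d - 1 : ℕ) : ℝ) * (|β| * N + a) ≤ c := le_max_left _ _
  refine ⟨2, -Real.log c, neg_pos.2 (Real.log_neg hc0 hc1), fun L _ W hW x i j R T hij _ _ hRL hTL => ?_⟩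
  exact (abs_wilsonLoop_le_of_isFluxLocal hN ha hcle hc1.le W hW x hij hRL hTL).trans
    (pow_bound_le_areaLawShape hc0 R T)

/-! ### Rows (Wilson units: `β_W = N·β` is the Wilson coupling of the tree slot `β`) -/

/-- **SU(2), `d = 4`**: the centre-tube area law whenever `β_W + a < 1/6` (`β_W = 2β`). [folklore] -/
theorem su2_areaLawCentreTube_dim4 {β a : ℝ} (ha : 0 ≤ a) (h : 2 * |β| + a < 1 / 6) : AreaLawCentreTube 2 4 β a :=
  areaLawCentreTube (le_refl 2) ha (by push_cast; linarith)

/-- **SU(2), `d = 3`**: the centre-tube area law whenever `β_W + a < 1/4`. [folklore] -/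
theorem su2_areaLawCentreTube_dim3 {β a : ℝ} (ha : 0 ≤ a) (h : 2 * |β| + a < 1 / 4) : AreaLawCentreTube 2 3 β a :=
  areaLawCentreTube (le_refl 2) ha (by push_cast; linarith)

/-- **SU(3), `d = 4`**: the centre-tube area law whenever `β_W + a < 1/6` (`β_W = 3β`). [folklore] -/
theorem su3_areaLawCentreTube_dim4 {β a : ℝ} (ha : 0 ≤ a) (h : 3 * |β| + a < 1 / 6) : AreaLawCentreTube 3 4 β a :=
  areaLawCentreTube (by norm_num) ha (by push_cast; linarith)

/-- **Every `SU(N)`, `d = 4`, 't Hooft scaling** (`β = N·βt`): the centre-tube area law whenever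
`6 (N² |βt| + a) < 1`. [folklore] -/
theorem suN_areaLawCentreTube_dim4 [NeZero N] (hN : 2 ≤ N) {βt a : ℝ} (ha : 0 ≤ a)
    (h : 6 * ((N : ℝ) ^ 2 * |βt| + a) < 1) : AreaLawCentreTube N 4 ((N : ℝ) * βt) a :=
  areaLawCentreTube hN ha (by
    have hNn : (0 : ℝ) ≤ N := Nat.cast_nonneg N
    rw [abs_mul, abs_of_nonneg hNn]; push_cast; nlinarith)

/-- **The SU(2) `d = 4` cell at `β_W = 1/8`, tube radius `a = 1/48`** (tree `β = 1/16`), explicit constants: every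
flux-local perturbation `W` of amplitude `1/48` — e.g. any linkwise centre-blind action plus any plaquette densities
of oscillation `≤ 1/24` — every torus, every non-wrapping `R × T` loop:
`|⟨W_{R×T}⟩_{1/16,W,L}| ≤ (4 · (7/8)^T)^R` (rate `log(8/7) ≈ 0.1335` per plaquette). [folklore] -/
theorem su2_wilsonLoop_le_oneEighth_tube [NeZero L] (W : Perturbation 4 L 2) (hW : IsFluxLocal (1 / 48) W)
    (x : Site 4 L) {i j : Fin 4} (hij : i ≠ j) {R T : ℕ} (hR : 2 * R ≤ L) (hT : 2 * T ≤ L) :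
    |W.expectation (fundamentalRep (Fin 2)) (1 / 16) (wilsonLoop (fundamentalRep (Fin 2)) x i j R T)| ≤
      (4 * (7 / 8 : ℝ) ^ T) ^ R :=
  abs_wilsonLoop_le_of_isFluxLocal (le_refl 2) (by norm_num) (by norm_num [abs_of_pos]) (by norm_num) W hW x hij hR hT

/-- **The SU(2) `d = 4` cell at `β_W = 1/12`, tube radius `a = 1/24`** (tree `β = 1/24`): `|⟨W_{R×T}⟩| ≤ (4 · (3/4)^T)^R`
— the same constants as gen 7's centre-blind cell at `β_W = 1/8`, now on a tube. [folklore] -/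
theorem su2_wilsonLoop_le_oneTwelfth_tube [NeZero L] (W : Perturbation 4 L 2) (hW : IsFluxLocal (1 / 24) W)
    (x : Site 4 L) {i j : Fin 4} (hij : i ≠ j) {R T : ℕ} (hR : 2 * R ≤ L) (hT : 2 * T ≤ L) :
    |W.expectation (fundamentalRep (Fin 2)) (1 / 24) (wilsonLoop (fundamentalRep (Fin 2)) x i j R T)| ≤
      (4 * (3 / 4 : ℝ) ^ T) ^ R :=
  abs_wilsonLoop_le_of_isFluxLocal (le_refl 2) (by norm_num) (by norm_num [abs_of_pos]) (by norm_num) W hW x hij hR hT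

/-! ### The tube-shaped corollary on the tier-2 ball: the ball hypothesis is idle -/

/-- **Window-free tier-2 area law on the flux-local tube** (members of the diameter-weighted ball `ClusterDomain κ ε₀ ε₁`
whose twist defect is flux-local with amplitude `a`, NO vertical window): holds for every `κ, ε₀, ε₁` — the ball
hypothesis is simply dropped. [folklore] -/
theorem areaLaw_clusterDomain_fluxLocal [NeZero N] (hN : 2 ≤ N) {β a : ℝ} (ha : 0 ≤ a)
    (hβ : 2 * ((d - 1 : ℕ) : ℝ) * (|β| * N + a) < 1) (κ ε₀ ε₁ : ℝ) :
    ∃ C c : ℝ, 0 < c ∧ ∀ (L : ℕ) [NeZero L] (W : Perturbation d L N), W ∈ ClusterDomain κ ε₀ ε₁ →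
      IsFluxLocal a W → ∀ (x : Site d L) (i j : Fin d) (R T : ℕ), i ≠ j → 1 ≤ R → 1 ≤ T → 2 * R ≤ L → 2 * T ≤ L →
        |W.expectation (fundamentalRep (Fin N)) β (wilsonLoop (fundamentalRep (Fin N)) x i j R T)| ≤
          C ^ (2 * (R + T)) * Real.exp (-c * (R * T)) := by
  obtain ⟨C, c, hc, h⟩ := areaLawCentreTube (d := d) hN ha hβ
  exact ⟨C, c, hc, fun L _ W _ hW => h L W hW⟩

end Summit.Ventures.YMGap.RobustBall

end
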